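import Summits.QuantumFields.YangMills.Theorems.LuscherReductionTwistedTraceScalingGaugeActionCovariant
import Summits.QuantumFields.YangMills.Theorems.LuscherReductionTwistedTraceScalingVacGradKernel
import Summits.QuantumFields.YangMills.Theorems.LuscherReductionTwistedTraceScalingCovariantCurlLipschitz
import HarnessLib

/-!
# The slice map `ξ ↦ P_Γ D_u ξ` is quantitatively injective on mean-zero gauge parameters for slow variables `u` near `1`
# (lane A of S-BASE, crux `TwistedTraceScaling` stmt-QuantumFields-20203, C4 INNER; design note `pub/ym-fleet/ym-luscher-20007-p1/COARSE-DESIGN.md` §23.6 (N1)–(N2))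

`…GaugeActionCovariant` showed that along a based gauge orbit through a tube point with slow variable `u` the relative coordinate moves, to first order, by
`−D_u ξ` (`covGrad`).  The slice of record is `P_Γ relLinkVec = 0` with `Γ = range(vacGrad)` the VACUUM gauge modes (`…RecordWeight`).  THIS FILE: the linear map
`ξ ↦ P_Γ (D_u ξ)` from mean-zero site fields to `Γ` is injective with an explicit lower bound when `u` is close to `1`:
* `covGradL u` — `covGrad` as a linear map into the Euclidean link space; `covGradL 1 = vacGrad` (★ `covGradL_one`);
* ★ `norm_covGradL_sub_vacGrad_le`: `‖D_u ξ − ∇ξ‖ ≤ 12·√(3|E|)·τ·‖ξ‖∞` when `|u⃗_k|∞ ≤ τ ≤ 1` (entry bound `|(Ad(u) − 1)_{ab}| ≤ 4τ`, `…CovariantCurlLipschitz`);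
* ★★ `norm_le_of_proj_covGradL` : with the Poincaré constant `C` of `exists_poincare_vacGrad` (`‖ξ‖∞ ≤ C‖∇ξ‖` on mean-zero `ξ`) and `12·√(3|E|)·τ·C ≤ 1/2`:
  `‖ξ‖∞ ≤ 2C·‖P_Γ(D_u ξ)‖` for every mean-zero `ξ` (projection is 1-Lipschitz and fixes `∇ξ ∈ Γ`);
* ★★ `exists_slice_injectivity`: `∃ C τ₀ > 0, ∀ u (|u⃗_k|∞ ≤ τ₀) ∀ ξ mean-zero, ‖ξ‖∞ ≤ C‖P_Γ(D_u ξ)‖`.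
So on the Born–Oppenheimer core (`|c| ≤ β^{-s} → 0`) the linearised slice equation `P_Γ(w − D_u ξ) = 0` has a unique mean-zero solution with `‖ξ‖∞ ≤ C‖P_Γ w‖`:
the linear input of (N1) (orbit meets slice, by inverse-function/contraction) and of (N2) (Gaussian evaluation of the Faddeev–Popov weight, whose quadratic form is
`‖P_Γ D_{u*} ξ‖²/δ_g²`).
HONEST FRAMING: finite-dimensional linear algebra for a stub of a child of the CONDITIONAL reduction route R2b1; no spectral claim; C4 OPEN; not a gap, not Clay.
-/

set_option autoImplicit false

noncomputable section

open MeasureTheory Filter Topology Real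
open scoped BigOperators Matrix
open Literature.MathematicalPhysics.QuantumFieldTheory
open Literature.MathematicalPhysics.QuantumLattice

namespace Summit.QuantumFields.YangMills.Theorems.FemtoTransferGap.TwoLattice.ConstTube

open Summit.QuantumFields.YangMills.Theorems.FemtoTransferGap
open Summit.QuantumFields.YangMills.Theorems.FemtoTransferGap.TwoLattice.Stiff (LinkSpace)
open Summit.QuantumFields.YangMills.Theorems.FemtoTransferGap.TwoLattice.Cov (abs_adRot_sub_one_le abs_vecPart_le_one)
open Literature.Algebra.EuclideanLattices (abs_apply_le_norm)

variable (L : ℕ) [NeZero L]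

/-! ## §1 The covariant gradient as a linear map into the link space -/

/-- The covariant gradient at `constLift u` as a linear map into the Euclidean link space: `(covGradL u ξ)_{(e,a)} = (Ad(u_k)ξ_y − ξ_x)_a`. [folklore] -/
def covGradL (u : GaugeConfig 3 1 SU2) : (Site 3 L → Fin 3 → ℝ) →ₗ[ℝ] LinkSpace L where
  toFun ξ := WithLp.toLp 2 fun ea : Edge 3 L × Fin 3 => covGrad L u ξ ea.1 ea.2
  map_add' ξ η := by
    ext ea
    simp only [covGrad, WithLp.ofLp_add, Pi.add_apply, Pi.sub_apply, Matrix.mulVec_add]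
    ring
  map_smul' c ξ := by
    ext ea
    simp only [covGrad, WithLp.ofLp_smul, Pi.smul_apply, Pi.sub_apply, Matrix.mulVec_smul, smul_eq_mul, RingHom.id_apply]
    ring

omit [NeZero L] in
/-- Components of `covGradL`. [folklore] -/
theorem covGradL_apply (u : GaugeConfig 3 1 SU2) (ξ : Site 3 L → Fin 3 → ℝ) (e : Edge 3 L) (a : Fin 3) :
    covGradL L u ξ (e, a) = ((adRot (u (0, e.2))).mulVec (ξ (e.1.shift e.2))) a - ξ e.1 a := rfl

omit [NeZero L] in
/-- ★ At `u = 1` the covariant gradient is the vacuum gradient. [folklore] -/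
theorem covGradL_one : covGradL L 1 = vacGrad L := by
  refine LinearMap.ext fun ξ => ?_
  ext ea
  rw [show ea = (ea.1, ea.2) from rfl, covGradL_apply, vacGrad_apply]
  simp [Cov.adRot_one]

omit [NeZero L] in
/-- The difference `D_u ξ − ∇ξ` componentwise: `((Ad(u_k) − 1) ξ_y)_a`. [folklore] -/
theorem covGradL_sub_vacGrad_apply (u : GaugeConfig 3 1 SU2) (ξ : Site 3 L → Fin 3 → ℝ) (e : Edge 3 L) (a : Fin 3) :
    (covGradL L u ξ - vacGrad L ξ) (e, a) = ((adRot (u (0, e.2)) - 1).mulVec (ξ (e.1.shift e.2))) a := by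
  rw [WithLp.ofLp_sub, Pi.sub_apply, covGradL_apply, vacGrad_apply, Matrix.sub_mulVec, Pi.sub_apply, Matrix.one_mulVec]
  ring

omit [NeZero L] in
/-- Entrywise: `|((Ad(u) − 1) v)_a| ≤ 12τ‖v‖∞` for `|u⃗|∞ ≤ τ ≤ 1`. [folklore] -/
theorem abs_adRot_sub_one_mulVec_le (W : SU2) {τ : ℝ} (hτ1 : τ ≤ 1) (hw : ∀ c, |vecPart W c| ≤ τ) (v : Fin 3 → ℝ) (a : Fin 3) :
    |((adRot W - 1).mulVec v) a| ≤ 12 * τ * ‖v‖ := by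
  rw [Matrix.mulVec, dotProduct]
  calc |∑ b, (adRot W - 1) a b * v b| ≤ ∑ b, |(adRot W - 1) a b * v b| := Finset.abs_sum_le_sum_abs _ _
    _ ≤ ∑ _b : Fin 3, 4 * τ * ‖v‖ := Finset.sum_le_sum fun b _ => by
        rw [abs_mul]
        exact mul_le_mul (abs_adRot_sub_one_le W hτ1 hw a b) (abs_apply_le_norm v b) (abs_nonneg _)
          (by linarith [(abs_nonneg _).trans (hw 0)])
    _ = 12 * τ * ‖v‖ := by rw [Finset.sum_const, Finset.card_univ, Fintype.card_fin]; ring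

/-- ★ `‖D_u ξ − ∇ξ‖ ≤ 12·√(3|E|)·τ·‖ξ‖∞` for `|u⃗_k|∞ ≤ τ ≤ 1`. [folklore] -/
theorem norm_covGradL_sub_vacGrad_le (u : GaugeConfig 3 1 SU2) {τ : ℝ} (hτ1 : τ ≤ 1) (hu : ∀ (k : Fin 3) (c : Fin 3), |vecPart (u (0, k)) c| ≤ τ)
    (ξ : Site 3 L → Fin 3 → ℝ) :
    ‖covGradL L u ξ - vacGrad L ξ‖ ≤ 12 * Real.sqrt (3 * Fintype.card (Edge 3 L)) * τ * ‖ξ‖ := by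
  have hτ0 : 0 ≤ τ := (abs_nonneg _).trans (hu 0 0)
  have hξ0 : 0 ≤ ‖ξ‖ := norm_nonneg ξ
  have hcomp : ∀ ea : Edge 3 L × Fin 3, ‖(covGradL L u ξ - vacGrad L ξ) ea‖ ^ 2 ≤ (12 * τ * ‖ξ‖) ^ 2 := fun ea => by
    rw [show ea = (ea.1, ea.2) from rfl, covGradL_sub_vacGrad_apply, Real.norm_eq_abs, sq_abs]
    have h := abs_adRot_sub_one_mulVec_le (u (0, ea.1.2)) hτ1 (hu ea.1.2) (ξ (ea.1.1.shift ea.1.2)) ea.2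
    have hy : ‖ξ (ea.1.1.shift ea.1.2)‖ ≤ ‖ξ‖ := norm_le_pi_norm ξ _
    have h' : |((adRot (u (0, ea.1.2)) - 1).mulVec (ξ (ea.1.1.shift ea.1.2))) ea.2| ≤ 12 * τ * ‖ξ‖ :=
      h.trans (mul_le_mul_of_nonneg_left hy (by positivity))
    exact pow_le_pow_left₀ (abs_nonneg _) h' 2 |> fun hh => by rw [sq_abs] at hh; exact hh
  have hsq : ‖covGradL L u ξ - vacGrad L ξ‖ ^ 2 ≤ (12 * Real.sqrt (3 * Fintype.card (Edge 3 L)) * τ * ‖ξ‖) ^ 2 := by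
    rw [EuclideanSpace.norm_sq_eq]
    calc ∑ ea, ‖(covGradL L u ξ - vacGrad L ξ) ea‖ ^ 2 ≤ ∑ _ea : Edge 3 L × Fin 3, (12 * τ * ‖ξ‖) ^ 2 := Finset.sum_le_sum fun ea _ => hcomp ea
      _ = (3 * Fintype.card (Edge 3 L)) * (12 * τ * ‖ξ‖) ^ 2 := by
          rw [Finset.sum_const, Finset.card_univ, nsmul_eq_mul, Fintype.card_prod, Fintype.card_fin]; push_cast; ring
      _ = (12 * Real.sqrt (3 * Fintype.card (Edge 3 L)) * τ * ‖ξ‖) ^ 2 := by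
          rw [show (12 * Real.sqrt (3 * Fintype.card (Edge 3 L)) * τ * ‖ξ‖) ^ 2 =
              Real.sqrt (3 * Fintype.card (Edge 3 L)) ^ 2 * (12 * τ * ‖ξ‖) ^ 2 by ring, Real.sq_sqrt (by positivity)]
  exact (abs_le_of_sq_le_sq' hsq (by positivity)).2

/-! ## §2 Quantitative injectivity of `P_Γ D_u` on mean-zero fields -/

/-- `∇ξ ∈ Γ`, so the projection fixes it. [folklore] -/
theorem proj_vacGrad (ξ : Site 3 L → Fin 3 → ℝ) : (gaugeModes L).starProjection (vacGrad L ξ) = vacGrad L ξ :=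
  Submodule.starProjection_eq_self_iff.mpr (LinearMap.mem_range_self _ ξ)

/-- ★★ **Quantitative injectivity of the slice map**: if `‖ξ‖∞ ≤ C‖∇ξ‖` on mean-zero fields and `12√(3|E|)·τ·C ≤ 1/2`, then for `|u⃗_k|∞ ≤ τ ≤ 1` and every mean-zero
`ξ`: `‖ξ‖∞ ≤ 2C·‖P_Γ(D_u ξ)‖`. [folklore] -/
theorem norm_le_of_proj_covGradL {C τ : ℝ} (hC : 0 < C) (hP : ∀ ξ : Site 3 L → Fin 3 → ℝ, ∑ x : Site 3 L, ξ x = 0 → ‖ξ‖ ≤ C * ‖vacGrad L ξ‖)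
    (hτ1 : τ ≤ 1) (hsmall : 12 * Real.sqrt (3 * Fintype.card (Edge 3 L)) * τ * C ≤ 1 / 2)
    (u : GaugeConfig 3 1 SU2) (hu : ∀ (k : Fin 3) (c : Fin 3), |vecPart (u (0, k)) c| ≤ τ)
    (ξ : Site 3 L → Fin 3 → ℝ) (hξ : ∑ x : Site 3 L, ξ x = 0) :
    ‖ξ‖ ≤ 2 * C * ‖(gaugeModes L).starProjection (covGradL L u ξ)‖ := by
  set P := (gaugeModes L).starProjection with hPdef
  have h1 : ‖ξ‖ ≤ C * ‖vacGrad L ξ‖ := hP ξ hξ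
  have h2 : ‖covGradL L u ξ - vacGrad L ξ‖ ≤ 12 * Real.sqrt (3 * Fintype.card (Edge 3 L)) * τ * ‖ξ‖ := norm_covGradL_sub_vacGrad_le L u hτ1 hu ξ
  -- `‖∇ξ‖ = ‖P ∇ξ‖ ≤ ‖P D_u ξ‖ + ‖P(∇ξ − D_u ξ)‖ ≤ ‖P D_u ξ‖ + ‖∇ξ − D_u ξ‖`
  have h3 : ‖vacGrad L ξ‖ ≤ ‖P (covGradL L u ξ)‖ + ‖covGradL L u ξ - vacGrad L ξ‖ := by
    have e1 : vacGrad L ξ = P (covGradL L u ξ) - P (covGradL L u ξ - vacGrad L ξ) := by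
      rw [map_sub, hPdef, proj_vacGrad]; abel
    calc ‖vacGrad L ξ‖ = ‖P (covGradL L u ξ) - P (covGradL L u ξ - vacGrad L ξ)‖ := by rw [← e1]
      _ ≤ ‖P (covGradL L u ξ)‖ + ‖P (covGradL L u ξ - vacGrad L ξ)‖ := norm_sub_le _ _
      _ ≤ ‖P (covGradL L u ξ)‖ + ‖covGradL L u ξ - vacGrad L ξ‖ := by
          gcongr; exact Submodule.norm_starProjection_apply_le _ _
  have hξ0 : 0 ≤ ‖ξ‖ := norm_nonneg ξ
  have h4 : C * ‖covGradL L u ξ - vacGrad L ξ‖ ≤ ‖ξ‖ / 2 := by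
    calc C * ‖covGradL L u ξ - vacGrad L ξ‖ ≤ C * (12 * Real.sqrt (3 * Fintype.card (Edge 3 L)) * τ * ‖ξ‖) := mul_le_mul_of_nonneg_left h2 hC.le
      _ = (12 * Real.sqrt (3 * Fintype.card (Edge 3 L)) * τ * C) * ‖ξ‖ := by ring
      _ ≤ (1 / 2) * ‖ξ‖ := mul_le_mul_of_nonneg_right hsmall hξ0
      _ = ‖ξ‖ / 2 := by ring
  have h5 : ‖ξ‖ ≤ C * ‖P (covGradL L u ξ)‖ + ‖ξ‖ / 2 := by
    calc ‖ξ‖ ≤ C * ‖vacGrad L ξ‖ := h1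
      _ ≤ C * (‖P (covGradL L u ξ)‖ + ‖covGradL L u ξ - vacGrad L ξ‖) := mul_le_mul_of_nonneg_left h3 hC.le
      _ = C * ‖P (covGradL L u ξ)‖ + C * ‖covGradL L u ξ - vacGrad L ξ‖ := by ring
      _ ≤ C * ‖P (covGradL L u ξ)‖ + ‖ξ‖ / 2 := by linarith
  linarith

/-- ★★ **THE SLICE MAP IS UNIFORMLY INJECTIVE NEAR `u = 1`**: there are `C, τ₀ > 0` (depending on `L` only) such that for every slow variable `u` with `|u⃗_k|∞ ≤ τ₀` and every
mean-zero `ξ`: `‖ξ‖∞ ≤ C·‖P_Γ(D_u ξ)‖`. [folklore] -/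
theorem exists_slice_injectivity : ∃ C τ₀ : ℝ, 0 < C ∧ 0 < τ₀ ∧ τ₀ ≤ 1 ∧
    ∀ u : GaugeConfig 3 1 SU2, (∀ (k : Fin 3) (c : Fin 3), |vecPart (u (0, k)) c| ≤ τ₀) →
      ∀ ξ : Site 3 L → Fin 3 → ℝ, ∑ x : Site 3 L, ξ x = 0 → ‖ξ‖ ≤ C * ‖(gaugeModes L).starProjection (covGradL L u ξ)‖ := by
  obtain ⟨C, hC, hP⟩ := exists_poincare_vacGrad L
  set M : ℝ := 12 * Real.sqrt (3 * Fintype.card (Edge 3 L)) with hM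
  have hM0 : 0 < M := by
    rw [hM]
    have : (0 : ℝ) < Fintype.card (Edge 3 L) := by exact_mod_cast Fintype.card_pos
    positivity
  refine ⟨2 * C, min 1 (1 / (2 * M * C)), by positivity, lt_min one_pos (by positivity), min_le_left _ _, fun u hu ξ hξ => ?_⟩
  refine norm_le_of_proj_covGradL L hC hP (min_le_left _ _) ?_ u hu ξ hξ
  calc M * min 1 (1 / (2 * M * C)) * C ≤ M * (1 / (2 * M * C)) * C := by gcongr; exact min_le_right _ _
    _ = 1 / 2 := by field_simp

/-- At `u = 1` itself: `‖ξ‖∞ ≤ C‖P_Γ ∇ξ‖ = C‖∇ξ‖` — the Poincaré inequality of `…VacGradKernel` in slice form. [folklore] -/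
theorem norm_le_proj_vacGrad : ∃ C : ℝ, 0 < C ∧ ∀ ξ : Site 3 L → Fin 3 → ℝ, ∑ x : Site 3 L, ξ x = 0 →
    ‖ξ‖ ≤ C * ‖(gaugeModes L).starProjection (vacGrad L ξ)‖ := by
  obtain ⟨C, hC, hP⟩ := exists_poincare_vacGrad L
  exact ⟨C, hC, fun ξ hξ => by rw [proj_vacGrad]; exact hP ξ hξ⟩

end Summit.QuantumFields.YangMills.Theorems.FemtoTransferGap.TwoLattice.ConstTube

end
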